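import Summits.NavierStokesRegularity.NavierStokesRegularity.Theorems.ExtremiserTransienceLocalMaximiserDefs
import Summits.NavierStokesRegularity.NavierStokesRegularity.Theorems.ExtremiserTransienceNearExtremalTransiencePerFlowMemberSelectionZoomInvariance
import Literature.Analysis.FluidPDE.FlatSwirlGauge
import Literature.Analysis.FluidPDE.KatoSymmetryCovariance
import HarnessLib

/-!
# Route `ExtremiserTransience`, crux `NearExtremalTransiencePerFlow` (stmt-NavierStokesRegularity-26567) —
# LINE g9-1 «local maximiser» (ns-idea-10 g9), stub L3 `Extraction`, part 1: THE AFFINE ZOOM CALCULUS OF THE LOCAL GAIN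

`--supports stmt-NavierStokesRegularity-26567` (helper; prover seat ns-net-p2 g11).  For the affine zoom
`azoom a b x₀ v = x ↦ a • v (x₀ + b • x)`: `curl`, `D`, `D curl` transform by the factors `ab`, `ab`, `ab²` at the moved point,
so the three densities `sd, zd, wd` of the local functional `F̃ = J − (κ/2)(μ⁻¹ Z + μ W)` (texts of record `…LocalMaximiserDefs`)
scale like `(ab)³, (ab)², (ab²)²`, and the LOCAL GAIN obeys
`locGain κ μ (azoom a b x₀ v) (azoom a b x₀ φ) = a³ · locGain (κ/a) (μ b) v φ` (`a ≠ 0`, `b > 0`).  With `a = M⁻¹`, `b = λ`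
this is the line's normalisation `x ↦ M⁻¹ v(x₀ + λx)` (height `1`, Taylor length `1`, constants `(κ⋆M, λ) ↦ (κ⋆, 1)`); the
admissible-test predicate `IsTestAt` is transported back along the inverse zoom, and the sign flip `v ↦ −v` (needed to make
the stretching positive) preserves `Zen, Wpa, lam, IsAdm, IsReg` and negates `Jst`.  Elementary calculus; nothing about
Navier–Stokes is used; no summit is proved by a line. [folklore]
-/

noncomputable section

open scoped Topology InnerProductSpace RealInnerProductSpace ENNReal ContDiff
open MeasureTheory Filter Set Metric Function
open Literature.Analysis Literature.Analysis.FluidPDE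
open Summit.NavierStokesRegularity.NavierStokesRegularity.Theorems.DepletionLadder.KStar.HalfSpace
open Summit.NavierStokesRegularity.NavierStokesRegularity.Theorems.DepletionLadder.KStar.BangBang

namespace Summit.NavierStokesRegularity.NavierStokesRegularity.Theorems

-- the problem directory repeats the summit name (`NavierStokesRegularity/NavierStokesRegularity`)
set_option linter.dupNamespace false

namespace NearExtremalTransiencePerFlow.LocalMaximiser

/-! ## The affine zoom -/


/-- The affine zoom `x ↦ a • v (x₀ + b • x)`. -/
def azoom (a b : ℝ) (x₀ : EuclideanSpace ℝ (Fin 3)) (v : EuclideanSpace ℝ (Fin 3) → EuclideanSpace ℝ (Fin 3)) :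
    EuclideanSpace ℝ (Fin 3) → EuclideanSpace ℝ (Fin 3) :=
  fun x => a • v (x₀ + b • x)

variable {a b : ℝ} {x₀ : EuclideanSpace ℝ (Fin 3)} {v φ : EuclideanSpace ℝ (Fin 3) → EuclideanSpace ℝ (Fin 3)}

/-- Unfolding the affine zoom. -/
theorem azoom_apply (a b : ℝ) (x₀ : EuclideanSpace ℝ (Fin 3)) (v : EuclideanSpace ℝ (Fin 3) → EuclideanSpace ℝ (Fin 3))
    (x : EuclideanSpace ℝ (Fin 3)) : azoom a b x₀ v x = a • v (x₀ + b • x) := rfl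

/-- The affine zoom is additive in the field. -/
theorem azoom_add (a b : ℝ) (x₀ : EuclideanSpace ℝ (Fin 3)) (v φ : EuclideanSpace ℝ (Fin 3) → EuclideanSpace ℝ (Fin 3)) :
    azoom a b x₀ (v + φ) = azoom a b x₀ v + azoom a b x₀ φ := by
  funext x; simp only [azoom, Pi.add_apply, smul_add]

/-- The affine zoom commutes with negation. -/
theorem azoom_neg (a b : ℝ) (x₀ : EuclideanSpace ℝ (Fin 3)) (v : EuclideanSpace ℝ (Fin 3) → EuclideanSpace ℝ (Fin 3)) :
    azoom a b x₀ (-v) = -azoom a b x₀ v := by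
  funext x; simp only [azoom, Pi.neg_apply, smul_neg]

/-- `curl (azoom a b x₀ v) x = (ab) • curl v (x₀ + b x)`. -/
theorem curl_azoom (a b : ℝ) (x₀ : EuclideanSpace ℝ (Fin 3)) (v : EuclideanSpace ℝ (Fin 3) → EuclideanSpace ℝ (Fin 3))
    (x : EuclideanSpace ℝ (Fin 3)) : curl (azoom a b x₀ v) x = (a * b) • curl v (x₀ + b • x) := by
  set w : EuclideanSpace ℝ (Fin 3) → EuclideanSpace ℝ (Fin 3) := fun y => v (y + x₀) with hw
  have h : azoom a b x₀ v = fun y => a • w (b • y) := by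
    funext y; simp only [azoom, hw, add_comm]
  rw [h, curl_smul_comp_smul, hw, curl_comp_add_const, add_comm]

/-- `D (azoom a b x₀ v) x = (ab) • D v (x₀ + b x)`. -/
theorem fderiv_azoom (a b : ℝ) (x₀ : EuclideanSpace ℝ (Fin 3)) (v : EuclideanSpace ℝ (Fin 3) → EuclideanSpace ℝ (Fin 3))
    (x : EuclideanSpace ℝ (Fin 3)) : fderiv ℝ (azoom a b x₀ v) x = (a * b) • fderiv ℝ v (x₀ + b • x) := by
  set w : EuclideanSpace ℝ (Fin 3) → EuclideanSpace ℝ (Fin 3) := fun y => v (y + x₀) with hw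
  have h : azoom a b x₀ v = fun y => a • w (b • y) := by
    funext y; simp only [azoom, hw, add_comm]
  rw [h, fderiv_const_smul_comp_smul_apply, hw, fderiv_comp_add_right, add_comm]

/-- `curl ∘ azoom` is itself a zoom of `curl v` (factor `ab`). -/
theorem curl_azoom_eq (a b : ℝ) (x₀ : EuclideanSpace ℝ (Fin 3)) (v : EuclideanSpace ℝ (Fin 3) → EuclideanSpace ℝ (Fin 3)) :
    curl (azoom a b x₀ v) = azoom (a * b) b x₀ (curl v) := by
  funext x; rw [curl_azoom]; rfl

/-- `D curl (azoom a b x₀ v) x = (ab²) • (D curl v)(x₀ + b x)`. -/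
theorem fderiv_curl_azoom (a b : ℝ) (x₀ : EuclideanSpace ℝ (Fin 3)) (v : EuclideanSpace ℝ (Fin 3) → EuclideanSpace ℝ (Fin 3))
    (x : EuclideanSpace ℝ (Fin 3)) :
    fderiv ℝ (curl (azoom a b x₀ v)) x = (a * b * b) • fderiv ℝ (curl v) (x₀ + b • x) := by
  rw [curl_azoom_eq, fderiv_azoom]


/-! ## Densities and the local gain under the zoom -/

section ZoomGain

variable (a b : ℝ) (x₀ : EuclideanSpace ℝ (Fin 3)) (v φ : EuclideanSpace ℝ (Fin 3) → EuclideanSpace ℝ (Fin 3))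

/-- Stretching density under the affine zoom: factor `(ab)³` at the moved point. -/
theorem sd_azoom (x : EuclideanSpace ℝ (Fin 3)) : sd (azoom a b x₀ v) x = (a * b) ^ 3 * sd v (x₀ + b • x) := by
  unfold sd
  rw [curl_azoom, fderiv_azoom, FunLike.coe_smul, Pi.smul_apply, map_smul, real_inner_smul_left, real_inner_smul_right,
    real_inner_smul_right]
  ring

/-- Enstrophy density under the affine zoom: factor `(ab)²` at the moved point. -/
theorem zd_azoom (x : EuclideanSpace ℝ (Fin 3)) : zd (azoom a b x₀ v) x = (a * b) ^ 2 * zd v (x₀ + b • x) := by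
  unfold zd
  rw [curl_azoom, norm_smul, Real.norm_eq_abs, mul_pow, sq_abs]

/-- Palinstrophy density under the affine zoom: factor `(ab²)²` at the moved point. -/
theorem wd_azoom (x : EuclideanSpace ℝ (Fin 3)) : wd (azoom a b x₀ v) x = (a * b * b) ^ 2 * wd v (x₀ + b • x) := by
  unfold wd
  rw [fderiv_curl_azoom, frobeniusNormSq_smul]

/-- Change of variables for the affine argument `x ↦ x₀ + b • x` (`b > 0`). -/
theorem integral_comp_affine_three {b : ℝ} (hb : 0 < b) (x₀ : EuclideanSpace ℝ (Fin 3)) (f : EuclideanSpace ℝ (Fin 3) → ℝ) :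
    ∫ x, f (x₀ + b • x) = (b ^ 3)⁻¹ * ∫ x, f x := by
  have h1 : ∫ x, f (x₀ + b • x) = ∫ x, (fun y => f (x₀ + y)) (b • x) := rfl
  rw [h1, DepletionLadder.integral_comp_smul_three hb (fun y => f (x₀ + y)), integral_add_left_eq_self]

/-- **The local gain under the affine zoom**: `locGain κ μ (azoom v) (azoom φ) = a³ · locGain (κ/a) (μ b) v φ`. -/
theorem locGain_azoom {a b : ℝ} (ha : a ≠ 0) (hb : 0 < b) (κ μ : ℝ) (x₀ : EuclideanSpace ℝ (Fin 3))
    (v φ : EuclideanSpace ℝ (Fin 3) → EuclideanSpace ℝ (Fin 3)) :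
    locGain κ μ (azoom a b x₀ v) (azoom a b x₀ φ) = a ^ 3 * locGain (κ / a) (μ * b) v φ := by
  unfold locGain
  rw [← azoom_add]
  simp_rw [sd_azoom, zd_azoom, wd_azoom]
  rw [integral_comp_affine_three hb x₀ (fun y => ((a * b) ^ 3 * sd (v + φ) y - (a * b) ^ 3 * sd v y -
      κ / 2 * (μ⁻¹ * ((a * b) ^ 2 * zd (v + φ) y - (a * b) ^ 2 * zd v y) +
        μ * ((a * b * b) ^ 2 * wd (v + φ) y - (a * b * b) ^ 2 * wd v y))))]
  rw [← integral_const_mul, ← integral_const_mul]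
  refine integral_congr_ae (Eventually.of_forall fun y => ?_)
  have hb0 : b ≠ 0 := hb.ne'
  field_simp

end ZoomGain

/-! ## Transport of admissible tests -/

section TestTransport

variable {a b : ℝ} {x₀ : EuclideanSpace ℝ (Fin 3)} {v φ : EuclideanSpace ℝ (Fin 3) → EuclideanSpace ℝ (Fin 3)}

/-- The affine zoom of a smooth field is smooth. -/
theorem contDiff_azoom (hφ : ContDiff ℝ (⊤ : ℕ∞) φ) (a b : ℝ) (x₀ : EuclideanSpace ℝ (Fin 3)) :
    ContDiff ℝ (⊤ : ℕ∞) (azoom a b x₀ φ) :=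
  (hφ.comp (contDiff_const.add (contDiff_const_smul b))).const_smul a

/-- The affine zoom of a divergence-free field is divergence free. -/
theorem isDivFree_azoom (hφ : ContDiff ℝ (⊤ : ℕ∞) φ) (hdiv : VectorCalculus.IsDivFree φ) (a b : ℝ)
    (x₀ : EuclideanSpace ℝ (Fin 3)) : VectorCalculus.IsDivFree (azoom a b x₀ φ) := by
  have h1 : VectorCalculus.IsDivFree (fun y => φ (y + x₀)) := hdiv.comp_add_right x₀
  have h2 : VectorCalculus.IsDivFree (fun x => (fun y => φ (y + x₀)) (b • x)) := h1.comp_smul b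
  have h3 : Differentiable ℝ (fun x => (fun y => φ (y + x₀)) (b • x)) :=
    ((hφ.differentiable (by simp)).comp (differentiable_id.add_const x₀)).comp (differentiable_id.const_smul b)
  have h4 := isDivFree_const_smul h2 h3 a
  have e : azoom a b x₀ φ = fun x => a • (fun y => φ (y + x₀)) (b • x) := by
    funext x; simp only [azoom, add_comm]
  rw [e]; exact h4

/-- The zoomed test vanishes wherever the original test vanishes at the moved point (closure included). -/
theorem mem_tsupport_of_mem_tsupport_azoom {x : EuclideanSpace ℝ (Fin 3)}
    (hx : x ∈ tsupport (azoom a b x₀ φ)) : x₀ + b • x ∈ tsupport φ := by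
  -- the affine map is a homeomorphism; supports map into supports
  have hcont : Continuous (fun y : EuclideanSpace ℝ (Fin 3) => x₀ + b • y) := continuous_const.add (continuous_const_smul b)
  have hsub : Function.support (azoom a b x₀ φ) ⊆ (fun y => x₀ + b • y) ⁻¹' Function.support φ := by
    intro y hy
    simp only [Function.mem_support, ne_eq, Set.mem_preimage] at hy ⊢
    intro h0; exact hy (by simp only [azoom, h0, smul_zero])
  exact (closure_mono hsub).trans (hcont.closure_preimage_subset _) hx

/-- The affine zoom (non-degenerate scale) of a compactly supported field is compactly supported. -/
theorem hasCompactSupport_azoom (hb : b ≠ 0) (hφ : HasCompactSupport φ) (a : ℝ) (x₀ : EuclideanSpace ℝ (Fin 3)) :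
    HasCompactSupport (azoom a b x₀ φ) := by
  -- `tsupport (azoom φ)` sits inside the continuous image of `tsupport φ` under the inverse affine map
  have hcont : Continuous (fun y : EuclideanSpace ℝ (Fin 3) => b⁻¹ • (y - x₀)) := by fun_prop
  refine IsCompact.of_isClosed_subset (hφ.image hcont) (isClosed_tsupport _) fun x hx => ?_
  refine ⟨x₀ + b • x, mem_tsupport_of_mem_tsupport_azoom hx, ?_⟩
  simp only [add_sub_cancel_left, smul_smul, inv_mul_cancel₀ hb, one_smul]

/-- Round trip: zooming the inversely zoomed test returns the test. -/
theorem azoom_azoom_inv (ha : a ≠ 0) (hb : b ≠ 0) (x₀ : EuclideanSpace ℝ (Fin 3))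
    (φ : EuclideanSpace ℝ (Fin 3) → EuclideanSpace ℝ (Fin 3)) :
    azoom a b x₀ (azoom a⁻¹ b⁻¹ (-(b⁻¹ • x₀)) φ) = φ := by
  funext x
  simp only [azoom, smul_add, smul_smul, mul_inv_cancel₀ ha, one_smul, inv_mul_cancel₀ hb]
  congr 1
  exact neg_add_cancel_left _ _

/-- **Test transport.** If `φ̃` is an admissible test of the normalised field `azoom M⁻¹ b x₀ v` at height `1`, then the physical
test `φ = azoom M b⁻¹ (−b⁻¹x₀) φ̃` is admissible for `v` at height `M` (`M > 0`, `b > 0`). -/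
theorem isTestAt_azoom_inv {M : ℝ} (hM : 0 < M) (hb : 0 < b) {ψ : EuclideanSpace ℝ (Fin 3) → EuclideanSpace ℝ (Fin 3)}
    (hψ : IsTestAt (azoom M⁻¹ b x₀ v) 1 ψ) : IsTestAt v M (azoom M b⁻¹ (-(b⁻¹ • x₀)) ψ) := by
  obtain ⟨hs, hc, hdiv, hle⟩ := hψ
  refine ⟨contDiff_azoom hs _ _ _, hasCompactSupport_azoom (inv_ne_zero hb.ne') hc _ _, isDivFree_azoom hs hdiv _ _ _,
    fun y hy => ?_⟩
  -- the moved point `x = b⁻¹ (y − x₀)` lies in `tsupport ψ`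
  have hx : -(b⁻¹ • x₀) + b⁻¹ • y ∈ tsupport ψ := mem_tsupport_of_mem_tsupport_azoom hy
  have h := hle _ hx
  have ey : x₀ + b • (-(b⁻¹ • x₀) + b⁻¹ • y) = y := by
    simp only [smul_add, smul_neg, smul_smul, mul_inv_cancel₀ hb.ne', one_smul, add_neg_cancel_left]
  rw [azoom_apply, ey] at h
  -- `‖M⁻¹ v y + ψ x‖ ≤ 1` ⇒ `‖v y + M ψ x‖ ≤ M`
  have h2 : v y + azoom M b⁻¹ (-(b⁻¹ • x₀)) ψ y = M • (M⁻¹ • v y + ψ (-(b⁻¹ • x₀) + b⁻¹ • y)) := by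
    rw [azoom_apply, smul_add, smul_smul, mul_inv_cancel₀ hM.ne', one_smul]
  rw [h2, norm_smul, Real.norm_eq_abs, abs_of_pos hM]
  calc M * ‖M⁻¹ • v y + ψ (-(b⁻¹ • x₀) + b⁻¹ • y)‖ ≤ M * 1 := mul_le_mul_of_nonneg_left h hM.le
    _ = M := mul_one M

/-- Support transport: `tsupport ψ ⊆ B(0, R)` gives `tsupport (azoom M b⁻¹ (−b⁻¹x₀) ψ) ⊆ B(x₀, R b)` (`b > 0`). -/
theorem tsupport_azoom_inv_subset {M R : ℝ} (hb : 0 < b) {ψ : EuclideanSpace ℝ (Fin 3) → EuclideanSpace ℝ (Fin 3)}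
    (hR : tsupport ψ ⊆ Metric.ball 0 R) : tsupport (azoom M b⁻¹ (-(b⁻¹ • x₀)) ψ) ⊆ Metric.ball x₀ (R * b) := by
  intro y hy
  have hx : -(b⁻¹ • x₀) + b⁻¹ • y ∈ Metric.ball (0 : EuclideanSpace ℝ (Fin 3)) R :=
    hR (mem_tsupport_of_mem_tsupport_azoom hy)
  rw [Metric.mem_ball, dist_zero_right, ← smul_neg, ← smul_add, norm_smul, Real.norm_eq_abs, abs_of_pos (inv_pos.2 hb),
    neg_add_eq_sub] at hx
  rw [Metric.mem_ball, dist_eq_norm]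
  have := (inv_mul_lt_iff₀ hb).1 hx
  linarith [this]

end TestTransport

/-! ## The sign flip -/

section SignFlip

variable {v : EuclideanSpace ℝ (Fin 3) → EuclideanSpace ℝ (Fin 3)}

/-- `curl (−v) = −curl v`. -/
theorem curl_neg_field (v : EuclideanSpace ℝ (Fin 3) → EuclideanSpace ℝ (Fin 3)) (x : EuclideanSpace ℝ (Fin 3)) :
    curl (-v) x = -curl v x := by
  have e : (-v) = fun y => (-1 : ℝ) • v ((1 : ℝ) • y) := by funext y; simp
  rw [e, curl_smul_comp_smul]; simp

/-- Enstrophy is even: `Z(−v) = Z(v)`. -/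
theorem Zen_neg (v : EuclideanSpace ℝ (Fin 3) → EuclideanSpace ℝ (Fin 3)) : Zen (-v) = Zen v := by
  unfold Zen; simp_rw [curl_neg_field, norm_neg]

/-- Palinstrophy is even: `W(−v) = W(v)`. -/
theorem Wpa_neg (v : EuclideanSpace ℝ (Fin 3) → EuclideanSpace ℝ (Fin 3)) : Wpa (-v) = Wpa v := by
  unfold Wpa
  have e : curl (-v) = -curl v := funext (curl_neg_field v)
  simp_rw [e, fderiv_neg, ← neg_one_smul ℝ (fderiv ℝ (curl v) _), frobeniusNormSq_smul]; simp

/-- Stretching is odd: `J(−v) = −J(v)`. -/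
theorem Jst_neg (v : EuclideanSpace ℝ (Fin 3) → EuclideanSpace ℝ (Fin 3)) : Jst (-v) = -Jst v := by
  unfold Jst
  rw [← integral_neg]
  refine integral_congr_ae (Eventually.of_forall fun x => ?_)
  simp [curl_neg_field, fderiv_neg]

/-- The Taylor length is even: `λ(−v) = λ(v)`. -/
theorem lam_neg (v : EuclideanSpace ℝ (Fin 3) → EuclideanSpace ℝ (Fin 3)) : lam (-v) = lam v := by
  unfold lam; rw [Zen_neg, Wpa_neg]

/-- The admissible class is closed under `v ↦ −v`. -/
theorem isAdm_neg {M B : ℝ} (h : IsAdm v M B) : IsAdm (-v) M B := by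
  obtain ⟨h1, h2, h3, h4, h5, h6, h7⟩ := h
  refine ⟨h1.neg, ?_, fun x => by simpa using h3 x, fun x => by simpa [fderiv_neg] using h4 x, ?_, ?_, ?_⟩
  · have e : (-v) = fun y => (-1 : ℝ) • v y := by funext y; simp
    rw [e]; exact isDivFree_const_smul h2 (h1.differentiable (by simp)) _
  · simpa [iteratedFDeriv_neg_apply] using h5
  · simpa [iteratedFDeriv_neg_apply] using h6
  · simpa [iteratedFDeriv_neg_apply] using h7

/-- `A`-regularity is preserved under `v ↦ −v`. -/
theorem isReg_neg {A : ℕ → ℝ} {M : ℝ} (h : IsReg A v M) : IsReg A (-v) M := by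
  intro j x
  rw [iteratedFDeriv_neg_apply, norm_neg, lam_neg]
  exact h j x

end SignFlip

end NearExtremalTransiencePerFlow.LocalMaximiser

end Summit.NavierStokesRegularity.NavierStokesRegularity.Theorems

end
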